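import Mathlib
import HarnessLib

/-!
# Endpoint-singularity substitutions: improper integrals as proper (box) integrals

**Statement.** The classical changes of variable of Davis–Rabinowitz, Sect. 2.12.3, that remove an algebraic
endpoint singularity, stated as identities of (interval) integrals that hold for EVERY integrand `f : ℝ → ℝ`
(no continuity or integrability hypothesis — both sides are Lebesgue integrals, and integrability transfers along
a monotone `C¹` substitution, `MeasureTheory.integral_Icc_deriv_smul_of_deriv_nonneg`):

* the power substitution `x = tⁿ` (`integral_pow_substitution`):
  `∫ x in 0..bⁿ, g x = ∫ t in 0..b, (n tⁿ⁻¹) g (tⁿ)` (`n ≥ 1`, `b ≥ 0`), and its translate to `[a, a + bⁿ]`;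
* `∫ x in 0..1, f x / √x = 2 ∫ t in 0..1, f (t²)` (`integral_div_sqrt_substitution`);
* `∫ x in 0..1, x^(-1/n) f x = n ∫ t in 0..1, tⁿ⁻² f (tⁿ)`, `n ≥ 2` (`integral_rpow_neg_inv_substitution`; DR (2.12.3));
* `∫ x in 0..a, x^(p/q) f x = q ∫ t in 0..a^(1/q), t^(p+q-1) f (t^q)` (`integral_rpow_div_substitution`);
* the Chebyshev substitution `x = cos t`: `∫ x in -1..1, f x / √(1 - x²) = ∫ t in 0..π, f (cos t)`
  (`integral_div_sqrt_one_sub_sq_substitution`);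
* `x = sin² t`: `∫ x in 0..1, f x / √(x (1 - x)) = 2 ∫ t in 0..π/2, f (sin² t)` (`integral_div_sqrt_mul_one_sub_substitution`).

**Why here.** A certified box-cubature engine (product Gauss–Legendre with a kernel-checked Bernstein-ellipse
remainder) needs an integrand analytic on a neighbourhood of the box; an integrable endpoint singularity
(`x^(-1/2)`, `(1 - x²)^(-1/2)`, …) defeats it, while the substituted integrand (`2 f (t²)`, `f (cos t)`, …) is as
smooth as `f`. These identities are the glue that lets such an engine certify improper integrals. The tree had
the substitutions only inside Mathlib's general Jacobian theorems; nothing in cubature-ready interval form.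

Honest framing: this is infrastructure for shared numerical engines serving client cells; rigour lives in the
verifiers (the kernel-checked certificate that consumes the box form); every published number belongs to a client
cell's ledger, not to the engines group. Nothing here is claimed as new mathematics.

References: P. J. Davis, P. Rabinowitz, *Methods of Numerical Integration*, 2nd ed. (1984), Sect. 1.11.1 (1.11.1)
(change of variable in a single integral; the example `x = u²`), Sect. 2.12.3 (change of variable eliminating the
singularity: `tⁿ = x`, `x = t^q`, `∫ f/(1-x²)^{1/2} = ∫₀^π f(cos t) dt`, `∫ f/(x(1-x))^{1/2} = 2∫₀^{π/2} f(sin² t) dt`).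

AI-produced formalisation (H21 engines group, seat eng-quad-3 gen 66, 2026-08-24); Lean 4 + Mathlib, no `sorry`,
standard axioms only.
-/

open _root_.MeasureTheory Set intervalIntegral Real
open scoped Interval

noncomputable section

namespace Literature.MeasureTheory.Integral

/-! ### The power substitution `x = tⁿ` -/

/-- **Power substitution** `x = tⁿ` on `[0, b]` (`n ≠ 0`, `0 ≤ b`), for every `g`:
`∫ x in 0..bⁿ, g x = ∫ t in 0..b, (n tⁿ⁻¹) g (tⁿ)`. No hypothesis on `g`: both sides are Lebesgue integrals and
integrability transfers along the monotone substitution. [cite: DavisRabinowitz1984, Sect. 1.11.1 (1.11.1)]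
[cite: DavisRabinowitz1984, Sect. 2.12.3] -/
theorem integral_pow_substitution (n : ℕ) (hn : n ≠ 0) {b : ℝ} (hb : 0 ≤ b) (g : ℝ → ℝ) :
    ∫ x in (0:ℝ)..b ^ n, g x = ∫ t in (0:ℝ)..b, (n * t ^ (n - 1)) * g (t ^ n) := by
  have h := integral_Icc_deriv_smul_of_deriv_nonneg (f := fun t : ℝ => t ^ n)
    (f' := fun t : ℝ => (n : ℝ) * t ^ (n - 1)) (g := g) (a := 0) (b := b)
    ((continuous_pow n).continuousOn) (fun t _ => hasDerivAt_pow n t)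
    (fun t ht => by have := ht.1; positivity) hb
  simp only [zero_pow hn, smul_eq_mul] at h
  rw [intervalIntegral.integral_of_le (pow_nonneg hb n), intervalIntegral.integral_of_le hb,
    ← integral_Icc_eq_integral_Ioc, ← integral_Icc_eq_integral_Ioc, h]

/-- Power substitution at a general left endpoint: `∫ x in a..a + bⁿ, g x = ∫ t in 0..b, (n tⁿ⁻¹) g (a + tⁿ)`.
[cite: DavisRabinowitz1984, Sect. 2.12.3] -/
theorem integral_pow_substitution_add (n : ℕ) (hn : n ≠ 0) (a : ℝ) {b : ℝ} (hb : 0 ≤ b) (g : ℝ → ℝ) :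
    ∫ x in a..a + b ^ n, g x = ∫ t in (0:ℝ)..b, (n * t ^ (n - 1)) * g (a + t ^ n) := by
  have h := integral_pow_substitution n hn hb (fun x => g (a + x))
  rw [← h, intervalIntegral.integral_comp_add_left g a, add_zero]

/-- **Square-root endpoint singularity** (`x = t²`; Davis–Rabinowitz's example): for every `f`,
`∫ x in 0..1, f x / √x = 2 ∫ t in 0..1, f (t²)` — the right-hand side is a proper integral with an integrand as
smooth as `f`. [cite: DavisRabinowitz1984, Sect. 1.11.1 (1.11.1)] [cite: DavisRabinowitz1984, Sect. 2.12.3] -/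
theorem integral_div_sqrt_substitution (f : ℝ → ℝ) :
    ∫ x in (0:ℝ)..1, f x / √x = 2 * ∫ t in (0:ℝ)..1, f (t ^ 2) := by
  have h := integral_pow_substitution 2 two_ne_zero zero_le_one (fun x => f x / √x)
  rw [one_pow] at h
  rw [h, ← intervalIntegral.integral_const_mul, intervalIntegral.integral_of_le zero_le_one,
    intervalIntegral.integral_of_le zero_le_one]
  refine setIntegral_congr_fun measurableSet_Ioc fun t ht => ?_
  have ht0 : 0 < t := ht.1
  simp only [Nat.cast_ofNat, pow_one, sqrt_sq ht0.le, show (2 : ℕ) - 1 = 1 from rfl]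
  field_simp

/-- **`x^(-1/n)` endpoint singularity** (`tⁿ = x`, Davis–Rabinowitz (2.12.3)): for `n ≥ 2` and every `f`,
`∫ x in 0..1, x^(-1/n) f x = n ∫ t in 0..1, tⁿ⁻² f (tⁿ)`, a proper integral. [cite: DavisRabinowitz1984, Sect. 2.12.3] -/
theorem integral_rpow_neg_inv_substitution {n : ℕ} (hn : 2 ≤ n) (f : ℝ → ℝ) :
    ∫ x in (0:ℝ)..1, x ^ (-(n:ℝ)⁻¹) * f x = n * ∫ t in (0:ℝ)..1, t ^ (n - 2) * f (t ^ n) := by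
  obtain ⟨m, rfl⟩ : ∃ m, n = m + 2 := ⟨n - 2, by omega⟩
  have hn0 : m + 2 ≠ 0 := by omega
  have h := integral_pow_substitution (m + 2) hn0 zero_le_one (fun x => x ^ (-((m + 2 : ℕ) : ℝ)⁻¹) * f x)
  rw [one_pow] at h
  rw [h, ← intervalIntegral.integral_const_mul, intervalIntegral.integral_of_le zero_le_one,
    intervalIntegral.integral_of_le zero_le_one]
  refine setIntegral_congr_fun measurableSet_Ioc fun t ht => ?_
  have ht0 : 0 < t := ht.1
  have hroot : (t ^ (m + 2)) ^ (-((m + 2 : ℕ) : ℝ)⁻¹) = t⁻¹ := by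
    rw [rpow_neg (pow_nonneg ht0.le _), pow_rpow_inv_natCast ht0.le hn0]
  rw [hroot, show m + 2 - 1 = m + 1 from rfl, show m + 2 - 2 = m from rfl, pow_succ]
  field_simp

/-- **Low-order algebraic behaviour `x^(p/q)`** (`x = t^q`): for every `f`, `q ≠ 0` and `a ≥ 0`,
`∫ x in 0..a, x^(p/q) f x = q ∫ t in 0..a^(1/q), t^(p+q-1) f (t^q)`. [cite: DavisRabinowitz1984, Sect. 2.12.3] -/
theorem integral_rpow_div_substitution (p : ℕ) {q : ℕ} (hq : q ≠ 0) {a : ℝ} (ha : 0 ≤ a) (f : ℝ → ℝ) :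
    ∫ x in (0:ℝ)..a, x ^ ((p:ℝ) / q) * f x =
      q * ∫ t in (0:ℝ)..a ^ ((q:ℝ)⁻¹), t ^ (p + q - 1) * f (t ^ q) := by
  have hb : 0 ≤ a ^ ((q:ℝ)⁻¹) := rpow_nonneg ha _
  have h := integral_pow_substitution q hq hb (fun x => x ^ ((p:ℝ) / q) * f x)
  rw [rpow_inv_natCast_pow ha hq] at h
  rw [h, ← intervalIntegral.integral_const_mul, intervalIntegral.integral_of_le hb,
    intervalIntegral.integral_of_le hb]
  refine setIntegral_congr_fun measurableSet_Ioc fun t ht => ?_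
  have ht0 : 0 < t := ht.1
  have hpow : (t ^ q) ^ ((p:ℝ) / q) = t ^ p := by
    rw [← rpow_natCast t q, ← rpow_mul ht0.le, ← rpow_natCast t p]
    congr 1
    field_simp
  obtain ⟨r, rfl⟩ : ∃ r, q = r + 1 := ⟨q - 1, by omega⟩
  rw [hpow, show r + 1 - 1 = r from rfl, show p + (r + 1) - 1 = p + r from by omega, pow_add]
  push_cast
  ring

/-! ### The trigonometric substitutions -/

/-- **Chebyshev substitution** `x = cos t`: for every `f`,
`∫ x in -1..1, f x / √(1 - x²) = ∫ t in 0..π, f (cos t)` (the weight of Gauss–Chebyshev quadrature becomes the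
constant weight). [cite: DavisRabinowitz1984, Sect. 2.12.3] -/
theorem integral_div_sqrt_one_sub_sq_substitution (f : ℝ → ℝ) :
    ∫ x in (-1:ℝ)..1, f x / √(1 - x ^ 2) = ∫ t in (0:ℝ)..π, f (cos t) := by
  have h := integral_Icc_deriv_smul_of_deriv_nonpos (f := cos) (f' := fun t => -sin t)
    (g := fun x => f x / √(1 - x ^ 2)) (a := 0) (b := π) continuous_cos.continuousOn
    (fun t _ => hasDerivAt_cos t) (fun t ht => neg_nonpos.2 (sin_nonneg_of_nonneg_of_le_pi ht.1.le ht.2.le))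
    pi_pos.le
  simp only [cos_pi, cos_zero, smul_eq_mul, neg_mul] at h
  rw [_root_.MeasureTheory.integral_neg, neg_inj] at h
  rw [intervalIntegral.integral_of_le (by norm_num : (-1:ℝ) ≤ 1), intervalIntegral.integral_of_le pi_pos.le,
    ← integral_Icc_eq_integral_Ioc, ← integral_Icc_eq_integral_Ioc, ← h, integral_Icc_eq_integral_Ioo,
    integral_Icc_eq_integral_Ioo]
  refine setIntegral_congr_fun measurableSet_Ioo fun t ht => ?_
  have hsin : 0 < sin t := sin_pos_of_pos_of_lt_pi ht.1 ht.2
  have hsq : √(1 - cos t ^ 2) = sin t := by rw [← sin_sq, sqrt_sq hsin.le]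
  rw [hsq]
  field_simp

/-- **`x = sin² t`** for the weight `(x (1 - x))^(-1/2)` on `[0, 1]`: for every `f`,
`∫ x in 0..1, f x / √(x (1 - x)) = 2 ∫ t in 0..π/2, f (sin² t)`. [cite: DavisRabinowitz1984, Sect. 2.12.3] -/
theorem integral_div_sqrt_mul_one_sub_substitution (f : ℝ → ℝ) :
    ∫ x in (0:ℝ)..1, f x / √(x * (1 - x)) = 2 * ∫ t in (0:ℝ)..π / 2, f (sin t ^ 2) := by
  have h := integral_Icc_deriv_smul_of_deriv_nonneg (f := fun t => sin t ^ 2)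
    (f' := fun t => 2 * sin t * cos t) (g := fun x => f x / √(x * (1 - x))) (a := 0) (b := π / 2)
    (by fun_prop) (fun t _ => ((hasDerivAt_pow 2 (sin t)).comp t (hasDerivAt_sin t)).congr_deriv (by norm_num))
    (fun t ht => by
      have hs : 0 ≤ sin t := sin_nonneg_of_nonneg_of_le_pi ht.1.le (ht.2.le.trans (by linarith [pi_pos]))
      have hc : 0 ≤ cos t := cos_nonneg_of_mem_Icc ⟨by linarith [pi_pos, ht.1], ht.2.le⟩
      positivity)
    (by positivity)
  simp only [sin_zero, sin_pi_div_two, one_pow, smul_eq_mul, zero_pow two_ne_zero] at h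
  rw [intervalIntegral.integral_of_le zero_le_one, intervalIntegral.integral_of_le (by positivity),
    ← integral_Icc_eq_integral_Ioc, ← integral_Icc_eq_integral_Ioc, ← h, integral_Icc_eq_integral_Ioo,
    integral_Icc_eq_integral_Ioo, ← _root_.MeasureTheory.integral_const_mul]
  refine setIntegral_congr_fun measurableSet_Ioo fun t ht => ?_
  have hsin : 0 < sin t := sin_pos_of_pos_of_lt_pi ht.1 (ht.2.trans (by linarith [pi_pos]))
  have hcos : 0 < cos t := cos_pos_of_mem_Ioo ⟨by linarith [pi_pos, ht.1], ht.2⟩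
  have hsq : √(sin t ^ 2 * (1 - sin t ^ 2)) = sin t * cos t := by
    rw [← cos_sq', ← mul_pow, sqrt_sq (mul_pos hsin hcos).le]
  rw [hsq]
  field_simp

end Literature.MeasureTheory.Integral
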